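import Mathlib
import HarnessLib

/-!
# Bondy's theorem on distinguishing coordinates, and the witness-pattern bound

S. Jukna, *Extremal Combinatorics — with applications in computer science* (1st ed., Springer 2001)
[Jukna2001], Chapter 12 "Witness sets and isolation", §12.1 "Bondy's theorem", Theorem 12.1
(Bondy 1972) and Proposition 12.2, with the proofs printed there; original:
J. A. Bondy, *Induced subsets*, J. Combin. Theory Ser. B 12 (1972) 201–202 [Bondy1972].

For a finite set `A` of vectors `v : ι → β` and a set of coordinates `S`, the *projection* `v|_S` is
the restriction of `v` to `S`; a set `S` is a *witness* for `u ∈ A` if every other `v ∈ A` differs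
from `u` on some coordinate of `S`.

* `card_image_restrict_lt_insert` — the step of the printed proof: if two members agree on `S` but
  differ at `i`, then `A|_{S ∪ {i}}` has more vectors than `A|_S`.
* `bondy` — **Theorem 12.1** (Bondy 1972): there is a set `S` of at most `|A| - 1` coordinates on
  which all members of `A` have distinct projections. (Printed for 0-1 vectors; the proof is
  alphabet-independent and we state it for arbitrary `β`.)
* `card_le_choose_mul_pow_of_witnesses` — **Proposition 12.2**: if every member of
  `A ⊆ βⁿ` has a witness of size `k` then `|A| ≤ binom(n,k) · |β|^k` (printed for `β = {0,1}`:
  "in every set of more than `2^k binom(n,k)` 0-1 vectors some vector has no witness of size `k`").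
-/

namespace Literature.Combinatorics.SetFamily

open Finset

variable {ι β : Type*} [DecidableEq ι] [DecidableEq β]

/-- The step in the printed proof of Bondy's theorem: if `u ≠ v ∈ A` coincide on `S` but differ on
the coordinate `i`, then the projection `A|_T`, `T = S ∪ {i}`, has at least one more vector than
`A|_S`. [cite: Jukna2001, Ch. 12 §12.1, proof of Theorem 12.1 ("the projection `A|_T` must have at
least one more vector than `A|_S`"); Bondy1972] -/
theorem card_image_restrict_lt_insert (A : Finset (ι → β)) (S : Finset ι) {i : ι} {u v : ι → β}
    (hu : u ∈ A) (hv : v ∈ A) (hS : ∀ j ∈ S, u j = v j) (hi : u i ≠ v i) :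
    (A.image fun (w : ι → β) (x : ↥S) => w x).card <
      (A.image fun (w : ι → β) (x : ↥(insert i S)) => w x).card := by
  -- `A|_S` is the image of `A|_T` under the restriction map `ρ`
  let ρ : (↥(insert i S) → β) → (↥S → β) := fun g x => g ⟨x.1, mem_insert_of_mem x.2⟩
  have hcomp : (A.image fun (w : ι → β) (x : ↥(insert i S)) => w x).image ρ =
      A.image fun (w : ι → β) (x : ↥S) => w x := by
    rw [image_image]
    rfl
  rw [← hcomp]
  refine lt_of_le_of_ne card_image_le fun hEq => ?_
  have hinj := card_image_iff.mp hEq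
  have h1 : (fun (x : ↥(insert i S)) => u x) ∈
      A.image (fun (w : ι → β) (x : ↥(insert i S)) => w x) := mem_image_of_mem _ hu
  have h2 : (fun (x : ↥(insert i S)) => v x) ∈
      A.image (fun (w : ι → β) (x : ↥(insert i S)) => w x) := mem_image_of_mem _ hv
  have huv := hinj h1 h2 (by funext x; exact hS x.1 x.2)
  exact hi (congrFun huv ⟨i, mem_insert_self i S⟩)

/-- **Theorem 12.1** (Bondy 1972). For every finite set `A` of vectors there is a set `S` of at most
`|A| - 1` coordinates such that all the projections `v|_S`, `v ∈ A`, are distinct: two members of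
`A` which agree on `S` are equal.

Printed proof: take a maximal `S` with `|A|_S| ≥ |S| + 1`; if two members coincided on `S`, adding a
coordinate where they differ would give a larger such set. We run this as an induction on `|S|`,
growing `S` one distinguishing coordinate at a time while `|A|_S| ≥ |S| + 1` and some two members
still coincide on `S`. [cite: Jukna2001, Ch. 12 §12.1, Theorem 12.1 and its proof;
Bondy1972] -/
theorem bondy (A : Finset (ι → β)) :
    ∃ S : Finset ι, S.card ≤ A.card - 1 ∧ ∀ u ∈ A, ∀ v ∈ A, (∀ i ∈ S, u i = v i) → u = v := by
  have claim : ∀ k : ℕ, ∃ S : Finset ι, S.card ≤ k ∧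
      ((∀ u ∈ A, ∀ v ∈ A, (∀ i ∈ S, u i = v i) → u = v) ∨
        k + 1 ≤ (A.image fun (w : ι → β) (x : ↥S) => w x).card) := by
    intro k
    induction k with
    | zero =>
      refine ⟨∅, le_rfl, ?_⟩
      rcases A.eq_empty_or_nonempty with hA | hA
      · left
        simp [hA]
      · right
        rw [zero_add, Nat.one_le_iff_ne_zero, ne_eq, card_eq_zero, image_eq_empty]
        exact hA.ne_empty
    | succ k ih =>
      obtain ⟨S, hSk, hS⟩ := ih
      by_cases hsep : ∀ u ∈ A, ∀ v ∈ A, (∀ i ∈ S, u i = v i) → u = v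
      · exact ⟨S, by omega, Or.inl hsep⟩
      have hk : k + 1 ≤ (A.image fun (w : ι → β) (x : ↥S) => w x).card := hS.resolve_left hsep
      push Not at hsep
      obtain ⟨u, hu, v, hv, huv, hne⟩ := hsep
      obtain ⟨i, hi⟩ : ∃ i, u i ≠ v i := Function.ne_iff.mp hne
      refine ⟨insert i S, (card_insert_le i S).trans (by omega), Or.inr ?_⟩
      have := card_image_restrict_lt_insert A S hu hv huv hi
      omega
  obtain ⟨S, hSk, hS⟩ := claim (A.card - 1)
  refine ⟨S, hSk, hS.elim id fun hk => ?_⟩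
  intro u hu v hv huv
  have hcardA : 0 < A.card := card_pos.mpr ⟨u, hu⟩
  have heq : (A.image fun (w : ι → β) (x : ↥S) => w x).card = A.card :=
    le_antisymm card_image_le (by omega)
  have hinj := card_image_iff.mp heq
  exact hinj hu hv (by funext x; exact huv x.1 x.2)

/-- Bondy's theorem in the printed setting: `m ≤ n` distinct vectors of length `n` are already
distinguished by some `m - 1` of the `n` coordinates. [cite: Jukna2001, Ch. 12 §12.1, Theorem 12.1
and the paragraph preceding it; Bondy1972] -/
theorem bondy_fin (n : ℕ) (A : Finset (Fin n → β)) :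
    ∃ S : Finset (Fin n), S.card ≤ A.card - 1 ∧
      Set.InjOn (fun (w : Fin n → β) (x : ↥S) => w x) A := by
  obtain ⟨S, hSk, hS⟩ := bondy A
  refine ⟨S, hSk, fun u hu v hv huv => hS u hu v hv fun i hi => ?_⟩
  exact congrFun huv ⟨i, hi⟩

section Witnesses

variable [Fintype ι] [Fintype β]

/-- **Proposition 12.2** (the pattern bound). If every vector `u` of a finite set `A` of vectors
`ι → β` (`|ι| = n`) has a witness of size `k` — a set `S_u` of `k` coordinates on which `u` differs
from every other member of `A` — then `|A| ≤ binom(n,k) · |β|^k`. Equivalently (as printed, for 0-1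
vectors): in every set of more than `2^k binom(n,k)` vectors some vector has no witness of size `k`.

Printed proof: the "pattern" `(S_u, u|_{S_u})` determines `u`, and there are at most
`binom(n,k) · 2^k` patterns; we count fibrewise over `S_u`. [cite: Jukna2001, Ch. 12 §12.1,
Proposition 12.2 and its proof] -/
theorem card_le_choose_mul_pow_of_witnesses (A : Finset (ι → β)) (k : ℕ)
    (hw : ∀ u ∈ A, ∃ S : Finset ι, S.card = k ∧ ∀ v ∈ A, v ≠ u → ∃ i ∈ S, u i ≠ v i) :
    A.card ≤ (Fintype.card ι).choose k * Fintype.card β ^ k := by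
  choose! W hWcard hW using hw
  have hmaps : ∀ u ∈ A, W u ∈ powersetCard k (univ : Finset ι) := fun u hu =>
    mem_powersetCard.mpr ⟨subset_univ _, hWcard u hu⟩
  rw [card_eq_sum_card_fiberwise hmaps]
  calc ∑ S ∈ powersetCard k univ, (A.filter fun u => W u = S).card
      ≤ ∑ S ∈ powersetCard k (univ : Finset ι), Fintype.card β ^ k := by
        refine sum_le_sum fun S hS => ?_
        have hSk : S.card = k := (mem_powersetCard.mp hS).2
        calc (A.filter fun u => W u = S).card
            ≤ (univ : Finset (↥S → β)).card := by
              refine card_le_card_of_injOn (fun (u : ι → β) (x : ↥S) => u x)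
                (fun _ _ => mem_coe.mpr (mem_univ _)) ?_
              intro u hu v hv huv
              obtain ⟨huA, huW⟩ := mem_filter.mp (mem_coe.mp hu)
              obtain ⟨hvA, -⟩ := mem_filter.mp (mem_coe.mp hv)
              by_contra hne
              obtain ⟨i, hi, hiuv⟩ := hW u huA v hvA (Ne.symm hne)
              rw [huW] at hi
              exact hiuv (congrFun huv ⟨i, hi⟩)
          _ = Fintype.card β ^ k := by
              rw [card_univ, Fintype.card_fun, Fintype.card_coe, hSk]
    _ = (Fintype.card ι).choose k * Fintype.card β ^ k := by
        rw [sum_const, card_powersetCard, card_univ, smul_eq_mul]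

/-- Proposition 12.2 as printed, for 0-1 vectors: if `|A| > 2^k · binom(n,k)` then some vector of `A`
has no witness of size `k`. [cite: Jukna2001, Ch. 12 §12.1, Proposition 12.2] -/
theorem exists_no_witness_of_card_gt (A : Finset (ι → Bool)) (k : ℕ)
    (hA : 2 ^ k * (Fintype.card ι).choose k < A.card) :
    ∃ u ∈ A, ∀ S : Finset ι, S.card = k → ∃ v ∈ A, v ≠ u ∧ ∀ i ∈ S, u i = v i := by
  by_contra! H
  have := card_le_choose_mul_pow_of_witnesses A k H
  rw [Fintype.card_bool, mul_comm] at this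
  omega

end Witnesses

end Literature.Combinatorics.SetFamily
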